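import Summits.ValiantsHypothesis.ValiantsHypothesis.Theorems.BorderApolarityFixedWitnessObstructionQPReduction

/-!
# Border apolarity — crux 4 `ToricWitnessObstructionQP` from `ToricDeborderQP` and eventual affine hardness

Route `ValiantsHypothesis/BorderApolarity`. The planner's glued split (rev 2026-08-16T07:15Z) filed crux 4
`ToricWitnessObstructionQP` (stmt-ValiantsHypothesis-14753: no H₀-stable border-apolar witness along a TORIC curve
`u · diag((t+2)^w) · g · det_m` in the quasi-polynomial window) with `ToricFixedPoints ∧ ToricWitnessObstructionQP ⇒
FixedWitnessObstructionQP` (support `ToricReduction`, closed). This file records, kernel-checked, that the residue of line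
`toric-face-debordering` of crux 2 (lead prover-line-stmt-ValiantsHypothesis-5778-1) is EXACTLY crux 4 modulo its two open
inputs: `ToricDeborderQP` (registered stub `stub_toricDeborderQP` of crux 2: an extremal toric representation of the padded
permanent at size `m` forces `dc(per_n) ≤ 2^((log₂ m + c₁)^c₁)`) and the EVENTUAL super-quasi-polynomial determinantal
complexity of the permanent (`stub_dcPerEventuallySuperQP`, external, VH-strength) imply `ToricWitnessObstructionQP` — by the
landed extremal socle step `stub_socleMax` (p83124: a toric witness forces `pp = u′ · in_{w′}(g′ · det_m)` extremal) and the
quasi-polynomial bookkeeping `qp_absorb` (…QPReduction.lean, p85323). No named fact is assumed; both inputs are hypotheses.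
-/

open scoped BigOperators Matrix
open Literature.Computability.AlgebraicComplexity

namespace Summit.ValiantsHypothesis.ValiantsHypothesis.Theorems.BorderApolarityFixedWitnessObstructionQP

/-- **`ToricDeborderQP ∧ eventual super-qp dc(per_n) ⇒ ToricWitnessObstructionQP` (crux 4, stmt-14753).** Given `c`, take
`c'` from `qp_absorb c c₁ 1 1` and `n₀ := max n₁ 3` (`n₁` from `hdc c'`); a toric witness `(u, g, w, J)` at `(n, m)` in the
window gives, by `stub_socleMax` (W2 ∧ W3 along the toric curve, W5), an extremal toric representation of `pp`, hence
`dc(per_n) ≤ 2^((log₂ m + c₁)^c₁) ≤ 2^((log₂ n + c')^c') < dc(per_n)`. The H₀-stability clause of the witness is not used.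
[folklore] -/
theorem toricWitnessObstructionQP_of_toricDeborderQP
    (hTD : ∃ c₁ : ℕ, ∀ (n m : ℕ) [NeZero m], 3 ≤ n → n ≤ m →
    (∃ (u g : Matrix.GeneralLinearGroup (Fin m × Fin m) ℂ) (w : Fin m × Fin m → ℕ) (e : ℕ),
        (∀ d ∈ (linSubst (Fin m × Fin m) ℂ (g : Matrix (Fin m × Fin m) (Fin m × Fin m) ℂ) (detPoly (Fin m) ℂ)).support,
          Finsupp.weight w d ≤ e) ∧
        paddedPerPoly ℂ n m =
          linSubst (Fin m × Fin m) ℂ (u : Matrix (Fin m × Fin m) (Fin m × Fin m) ℂ)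
            (MvPolynomial.weightedHomogeneousComponent w e
              (linSubst (Fin m × Fin m) ℂ (g : Matrix (Fin m × Fin m) (Fin m × Fin m) ℂ) (detPoly (Fin m) ℂ)))) →
      determinantalComplexity (perPoly (Fin n) ℂ) ≤ 2 ^ ((Nat.log 2 m + c₁) ^ c₁))
    (hdc : ∀ c : ℕ, ∃ n₀ : ℕ, ∀ n ≥ n₀,
    2 ^ ((Nat.log 2 n + c) ^ c) < determinantalComplexity (perPoly (Fin n) ℂ)) :
    Summit.ValiantsHypothesis.ValiantsHypothesis.Theses.BorderApolarity.ToricWitnessObstructionQP := by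
  obtain ⟨c₁, hTD⟩ := hTD
  intro c
  obtain ⟨c', hc'⟩ := qp_absorb c c₁ 1 1
  obtain ⟨n₁, hn₁⟩ := hdc c'
  refine ⟨max n₁ 3, ?_⟩
  intro n hn m inst hnm hm
  have h3 : 3 ≤ n := le_trans (le_max_right _ _) hn
  have hn₁' : n₁ ≤ n := le_trans (le_max_left _ _) hn
  have hS := @stub_socleMax n m inst h3 hnm
  dsimp only at hS ⊢
  rintro ⟨u, g, w, J, hW2, hW3, -, hW5⟩
  have hdc' := @hTD n m inst h3 hnm (hS J u g w ⟨hW2, hW3⟩ hW5)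
  have hle := hc' n m hm
  have hlt := hn₁ n hn₁'
  have hB : 2 ^ ((Nat.log 2 m + c₁) ^ c₁) ≤ 1 * ((m + 1) * (2 ^ ((Nat.log 2 m + c₁) ^ c₁) + 1)) ^ 1 := by
    rw [one_mul, pow_one]
    nlinarith [Nat.zero_le m, Nat.zero_le (2 ^ ((Nat.log 2 m + c₁) ^ c₁))]
  exact (lt_irrefl _ (hlt.trans_le ((hdc'.trans hB).trans hle))).elim

end Summit.ValiantsHypothesis.ValiantsHypothesis.Theorems.BorderApolarityFixedWitnessObstructionQP
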